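import Mathlib
import Summits.NavierStokesRegularity.FluidComputer.SkewCutGalerkinRealShell
import Summits.NavierStokesRegularity.FluidComputer.SkewCutGalerkinSectionData

/-!
# Skew-cut X0 certificate END-TO-END FROM TRANSCRIPT-SHAPED DATA ONLY (generic real banded matrix)
(instab3 g6 — implementation 1 of the skew-cut X0 certifier, cell `ns-blowup`, 2026-08-27)

HONEST FRAMING (human rulings D-0035/D-0074): nothing here is a claim about Navier–Stokes
blow-up. WHAT THIS IS NOT: not NS evidence. MODEL-lane format bookkeeping; no certificate, printed
number or census word is moved.

The two halves of the X0 chain now both start from the certifiers' own data: EXISTENCE of section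
eigenpairs for every finer section (`SkewCutGalerkinSectionData.section_data_of_transcripts`, with
the uniform graph bound from `SkewCutGalerkinSectionGraphBound`) and the OPEN-bracket end-to-end
statement from real Theorem-R data (`SkewCutGalerkinRealShell`). The data sets COINCIDE: at each end
`z ∈ {a, e}` the certifier verifies a left inverse `N_z` of the head matrix `[(z − ℓ_j)δ − a_ij]_H`
(with its bounds `α, β_B, β_C`), ONE real shell test `MU2_z |x|² ≤ xᵀ(Λ_{K+1} − s)x − xᵀ(C N_z B)x`
(`λ_min(Λ_{K+1} − s − sym(C_K N_K B_K)) ≥ MU2_z`, the (V5) test), the tail number off the cube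
`K+1`, and the two head determinants have opposite signs. `exists_smooth_eigenvector_Ioo_of_transcripts`
composes the two: from a Hilbert basis with levels, a REAL banded first-order matrix with the chain's
structural bounds (band, growth, comparable weights, Schur sums), the section pairing bound, nested
cubes `H ⊆ S₁ ⊆ F_n` with locality, and EXACTLY this transcript-shaped data at `a` and `e` — to a
bounded `T` with matrix `t`, an eigenvalue `λ ∈ (a, e)` and a unit `H^∞` eigenvector. The shape
conversions between the two files' hypotheses (`x : ι → ℝ` vanishing on the head vs. vectors on the
shell subtype; functional vs. matrix left inverse) are §1.

Mathlib + the two files named; no definitions. [folklore]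
-/

noncomputable section

namespace Summit.NavierStokesRegularity.FluidComputer.SkewCutGalerkinFromTranscripts

open Filter Topology Matrix Finset
open scoped BigOperators InnerProductSpace ComplexConjugate

variable {𝕜 : Type*} [RCLike 𝕜] {ι : Type*} [DecidableEq ι]

/-! ### §1 Shape conversions -/

omit [DecidableEq ι] in
/-- The complex section pairing hypothesis on a real first-order matrix gives the real one. -/
theorem real_pairing_of_complex (t : ι → ι → 𝕜) (x₀ : ℝ) (ℓ : ι → ℝ) (ar : ι → ι → ℝ)
    (har : ∀ i j, t i j * ((x₀ : 𝕜) - (ℓ j : 𝕜)) = (ar i j : 𝕜)) {s : ℝ}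
    (hA : ∀ (G : Finset ι) (u : ι → 𝕜),
      RCLike.re (∑ i ∈ G, ∑ j ∈ G, conj (u i) * (t i j * ((x₀ : 𝕜) - (ℓ j : 𝕜))) * u j) ≤
        s * ∑ i ∈ G, ‖u i‖ ^ 2) :
    ∀ (G : Finset ι) (u : ι → ℝ), ∑ i ∈ G, ∑ j ∈ G, u i * ar i j * u j ≤ s * ∑ i ∈ G, u i ^ 2 := by
  intro G u
  have h := hA G (fun i => (u i : 𝕜))
  simp_rw [har] at h
  have hl : RCLike.re (∑ i ∈ G, ∑ j ∈ G, conj ((u i : ℝ) : 𝕜) * ((ar i j : ℝ) : 𝕜) * ((u j : ℝ) : 𝕜)) =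
      ∑ i ∈ G, ∑ j ∈ G, u i * ar i j * u j := by
    rw [map_sum]; refine Finset.sum_congr rfl fun i _ => ?_
    rw [map_sum]; refine Finset.sum_congr rfl fun j _ => ?_
    rw [RCLike.conj_ofReal, ← RCLike.ofReal_mul, ← RCLike.ofReal_mul, RCLike.ofReal_re]
  have hr : ∑ i ∈ G, ‖((u i : ℝ) : 𝕜)‖ ^ 2 = ∑ i ∈ G, u i ^ 2 :=
    Finset.sum_congr rfl fun i _ => by rw [RCLike.norm_ofReal, sq_abs]
  rw [hl, hr] at h
  exact h

omit [DecidableEq ι] in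
/-- A real first-order matrix vanishing off the band vanishes off the band (as a real matrix). -/
theorem ar_eq_zero_of_not_mem (t : ι → ι → 𝕜) (x₀ : ℝ) (ℓ : ι → ℝ) (ar : ι → ι → ℝ)
    (har : ∀ i j, t i j * ((x₀ : 𝕜) - (ℓ j : 𝕜)) = (ar i j : 𝕜)) (nbr : ι → Finset ι)
    (ht0 : ∀ i j, j ∉ nbr i → t i j = 0) : ∀ i j, j ∉ nbr i → ar i j = 0 := by
  intro i j hj
  have h := har i j
  rw [ht0 i j hj, zero_mul] at h
  exact_mod_cast h.symm

omit [DecidableEq ι] in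
/-- Growth of the real first-order matrix from the chain's growth hypothesis. -/
theorem abs_ar_le (t : ι → ι → 𝕜) (x₀ : ℝ) (ℓ : ι → ℝ) (ar : ι → ι → ℝ)
    (har : ∀ i j, t i j * ((x₀ : 𝕜) - (ℓ j : 𝕜)) = (ar i j : 𝕜)) (nbr : ι → Finset ι)
    (wgt : ι → ℝ) {Kg : ℝ} (ha : ∀ i j, j ∈ nbr i → ‖t i j * ((x₀ : 𝕜) - (ℓ j : 𝕜))‖ ≤ Kg * wgt j) :
    ∀ i j, j ∈ nbr i → |ar i j| ≤ Kg * wgt j := by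
  intro i j hj
  have h := ha i j hj
  rwa [har, RCLike.norm_ofReal] at h

/-- A functional left-inverse identity is the matrix identity `N * A = 1` on the head. -/
theorem matrix_leftInverse_of_fun (ℓ : ι → ℝ) (ar : ι → ι → ℝ) (H : Finset ι) (z : ℝ)
    (Br : ↥H → ↥H → ℝ)
    (hBr : ∀ (v : ↥H → ℝ) (j : ↥H), ∑ m : ↥H, Br j m * ((z - ℓ m) * v m - ∑ l : ↥H, ar m l * v l) = v j) :
    (Matrix.of fun j m : ↥H => Br j m) *
      (Matrix.of fun i j : ↥H => (if i = j then z - ℓ j else 0) - ar i j) = 1 := by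
  rw [Matrix.ext_iff_mulVec]
  intro v
  rw [← Matrix.mulVec_mulVec, Matrix.one_mulVec]
  funext j
  rw [Matrix.mulVec, dotProduct]
  have hin : ∀ m : ↥H, ((Matrix.of fun i j : ↥H => (if i = j then z - ℓ j else 0) - ar i j) *ᵥ v) m =
      (z - ℓ m) * v m - ∑ l : ↥H, ar m l * v l := by
    intro m
    rw [Matrix.mulVec, dotProduct]
    simp only [Matrix.of_apply, sub_mul, Finset.sum_sub_distrib, ite_mul, zero_mul]
    rw [Finset.sum_ite_eq Finset.univ m]
    simp
  simp only [Matrix.of_apply, hin]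
  exact hBr v j

/-- **The shell test on vectors vanishing on the head gives the shell form on the shell subtype**
(the `hX` input of `SkewCutGalerkinSectionData` from the `hshell` input of `SkewCutGalerkinRealShell`),
using locality: the band of the head `H` lies in `S₁`, the band is symmetric and carries the matrix. -/
theorem shellForm_of_shellTest (ℓ : ι → ℝ) (ar : ι → ι → ℝ) (nbr : ι → Finset ι)
    (hsymm : ∀ i j, j ∈ nbr i ↔ i ∈ nbr j) (har0 : ∀ i j, j ∉ nbr i → ar i j = 0)
    (H S₁ : Finset ι) (hloc : ∀ i ∈ H, nbr i ⊆ S₁) (z s MU2 : ℝ) (Br : ↥H → ↥H → ℝ)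
    (hshell : ∀ x : ι → ℝ, (∀ i ∈ H, x i = 0) →
      MU2 * ∑ i ∈ S₁ \ H, x i ^ 2 ≤ ∑ i ∈ S₁ \ H, (z - ℓ i - s) * x i ^ 2 -
        ∑ i ∈ H.biUnion nbr \ H,
          (∑ j : ↥H, ar i j * ∑ m : ↥H, Br j m * ∑ l ∈ nbr m \ H, ar m l * x l) * x i) :
    ∀ w : ↥(S₁ \ H) → ℝ, MU2 * ∑ i, w i ^ 2 ≤ ∑ i : ↥(S₁ \ H), (z - ℓ i.1 - s) * w i ^ 2 -
      w ⬝ᵥ (((Matrix.of fun (i : ↥(S₁ \ H)) (j : ↥H) => -ar i j) * (Matrix.of fun j m : ↥H => Br j m) *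
        (Matrix.of fun (i : ↥H) (j : ↥(S₁ \ H)) => -ar i j)) *ᵥ w) := by
  intro w
  -- extend `w` by zero
  let x : ι → ℝ := fun i => if h : i ∈ S₁ \ H then w ⟨i, h⟩ else 0
  have hxP : ∀ i : ↥(S₁ \ H), x i.1 = w i := fun i => by simp only [x, dif_pos i.2]
  have hxH : ∀ i ∈ H, x i = 0 := fun i hi => by
    have : i ∉ S₁ \ H := fun h => (Finset.mem_sdiff.mp h).2 hi
    simp only [x, dif_neg this]
  have hx0 : ∀ i ∉ S₁ \ H, x i = 0 := fun i hi => by simp only [x, dif_neg hi]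
  have key := hshell x hxH
  -- squares
  have e1 : ∑ i ∈ S₁ \ H, x i ^ 2 = ∑ i : ↥(S₁ \ H), w i ^ 2 := by
    rw [← Finset.sum_coe_sort]; exact Finset.sum_congr rfl fun i _ => by rw [hxP]
  have e2 : ∑ i ∈ S₁ \ H, (z - ℓ i - s) * x i ^ 2 = ∑ i : ↥(S₁ \ H), (z - ℓ i.1 - s) * w i ^ 2 := by
    rw [← Finset.sum_coe_sort]; exact Finset.sum_congr rfl fun i _ => by rw [hxP]
  -- the inner coupling `B x` on the shell subtype
  have e3 : ∀ m : ↥H, ∑ l ∈ nbr m \ H, ar m l * x l = ∑ l : ↥(S₁ \ H), ar m l * w l := by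
    intro m
    have hsub : nbr m \ H ⊆ S₁ \ H := fun l hl => by
      have hl' := Finset.mem_sdiff.mp hl
      exact Finset.mem_sdiff.mpr ⟨hloc m m.2 hl'.1, hl'.2⟩
    rw [Finset.sum_subset hsub fun l hl hln => by
      have : l ∉ nbr m := fun h => hln (Finset.mem_sdiff.mpr ⟨h, (Finset.mem_sdiff.mp hl).2⟩)
      rw [har0 m l this, zero_mul], ← Finset.sum_coe_sort]
    exact Finset.sum_congr rfl fun l _ => by rw [hxP]
  -- the cross term on the shell subtype
  have e4 : ∑ i ∈ H.biUnion nbr \ H,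
      (∑ j : ↥H, ar i j * ∑ m : ↥H, Br j m * ∑ l ∈ nbr m \ H, ar m l * x l) * x i =
      ∑ i : ↥(S₁ \ H), (∑ j : ↥H, ar i j * ∑ m : ↥H, Br j m * ∑ l : ↥(S₁ \ H), ar m l * w l) * w i := by
    have hsub : H.biUnion nbr \ H ⊆ S₁ \ H := fun i hi => by
      have hi' := Finset.mem_sdiff.mp hi
      obtain ⟨j, hj, hij⟩ := Finset.mem_biUnion.mp hi'.1
      exact Finset.mem_sdiff.mpr ⟨hloc j hj hij, hi'.2⟩
    rw [Finset.sum_subset hsub fun i hi hin => by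
      -- off the band of the head every `ar i j`, `j ∈ H`, vanishes
      have hz : ∀ j : ↥H, ar i j = 0 := fun j => by
        refine har0 i j fun h => hin (Finset.mem_sdiff.mpr ⟨?_, (Finset.mem_sdiff.mp hi).2⟩)
        exact Finset.mem_biUnion.mpr ⟨j, j.2, (hsymm i j).mp h⟩
      simp [hz], ← Finset.sum_coe_sort]
    refine Finset.sum_congr rfl fun i _ => ?_
    simp_rw [e3, hxP]
  -- the matrix form
  have e5 : w ⬝ᵥ (((Matrix.of fun (i : ↥(S₁ \ H)) (j : ↥H) => -ar i j) *
      (Matrix.of fun j m : ↥H => Br j m) * (Matrix.of fun (i : ↥H) (j : ↥(S₁ \ H)) => -ar i j)) *ᵥ w) =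
      ∑ i : ↥(S₁ \ H), (∑ j : ↥H, ar i j * ∑ m : ↥H, Br j m * ∑ l : ↥(S₁ \ H), ar m l * w l) * w i := by
    rw [dotProduct]
    refine Finset.sum_congr rfl fun i _ => ?_
    rw [← Matrix.mulVec_mulVec, ← Matrix.mulVec_mulVec, mul_comm]
    congr 1
    rw [Matrix.mulVec, dotProduct]
    refine Finset.sum_congr rfl fun j _ => ?_
    rw [Matrix.of_apply, Matrix.mulVec, dotProduct]
    have : ∀ m : ↥H, (Matrix.of fun j m : ↥H => Br j m) j m *
        ((Matrix.of fun (i : ↥H) (j : ↥(S₁ \ H)) => -ar i j) *ᵥ w) m =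
        -(Br j m * ∑ l : ↥(S₁ \ H), ar m l * w l) := by
      intro m
      rw [Matrix.of_apply, Matrix.mulVec, dotProduct]
      simp only [Matrix.of_apply, neg_mul, Finset.sum_neg_distrib, mul_neg]
    simp_rw [this]
    rw [Finset.sum_neg_distrib]
    ring
  rw [e1, e2, e4] at key
  rw [e5]
  exact key

/-! ### §2 END-TO-END from transcript-shaped data only -/

/-- **SKEW-CUT X0 CERTIFICATE, END-TO-END FROM TRANSCRIPT-SHAPED DATA ONLY** (generic real banded
matrix in a Hilbert basis). STRUCTURE: Hilbert basis `b`, levels `ℓ ≤ 0` with resolvent symbol `d`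
at a base point `x₀ ≥ e`, a first-order matrix `t` with REAL entries `t_ij(x₀ − ℓ_j) = ar_ij`,
symmetric band of width `W` carrying `t`, growth / comparable weights / Schur sums (the chain's (A1),
(A2)), the SECTION PAIRING bound with constant `s`; nested finite sets `H ⊆ S₁` (head cube and the
next cube) with LOCALITY `nbr i ⊆ S₁` for `i ∈ H`, and a monotone exhausting family of finite sections
`F_n ⊇ S₁`. TRANSCRIPT-SHAPED DATA at each end `z ∈ {a, e}`, `a < e`: a real matrix `Br_z` on `H`
with the left-inverse identity for `[(z − ℓ_j)δ − ar_ij]_H` and its bounds `α, β_B, β_C`; ONE real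
shell test `MU2_z Σ_{S₁∖H} x_i² ≤ Σ_{S₁∖H} (z − ℓ_i − s) x_i² − xᵀ(C Br_z B)x` (`MU2_z > 0`; the
(V5) test `λ_min(Λ_{K+1} − s − sym(C_K N_K B_K)) ≥ MU2`); the tail number `MU2_z ≤ z − ℓ_i − s` off
`S₁`; and opposite head determinant signs. CONCLUSION: a bounded `T` with matrix `t`,
`‖T‖ ≤ √(R₀C₀)`, an eigenvalue `λ ∈ (a, e)` of the operator in coordinates
(`ℓ_i v_i + Σ_j a_ij v_j = λ v_i`) with a unit eigenvector whose coordinates have every polynomial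
moment (`H^∞`). Composition of `SkewCutGalerkinSectionData.section_data_of_transcripts` (existence of
the section eigenpairs + graph bound) with
`SkewCutGalerkinRealShell.exists_smooth_eigenvector_Ioo_of_sections_of_real_resolvent_data` (limit +
open bracket); MODEL-lane format theorem, no number is moved. -/
theorem exists_smooth_eigenvector_Ioo_of_transcripts
    {H : Type*} [NormedAddCommGroup H] [InnerProductSpace 𝕜 H] [CompleteSpace H]
    (b : HilbertBasis ι 𝕜 H)
    -- structure: levels, base point, resolvent symbol
    (ℓ : ι → ℝ) (hℓ : ∀ i, ℓ i ≤ 0) (x₀ : ℝ) (d : lp (fun _ : ι => 𝕜) ⊤)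
    (hd : ∀ i, d i * ((x₀ : 𝕜) - (ℓ i : 𝕜)) = 1) (hd0 : Tendsto (fun i => ‖d i‖) cofinite (𝓝 0))
    -- structure: the first-order matrix (relative bound `t`, real entries `ar`), Schur sums, band
    (t : ι → ι → 𝕜) {R₀ C₀ : ℝ} (hrow : ∀ i, Summable fun j => ‖t i j‖)
    (hR : ∀ i, ∑' j, ‖t i j‖ ≤ R₀) (hcol : ∀ j, Summable fun i => ‖t i j‖)
    (hC₀ : ∀ j, ∑' i, ‖t i j‖ ≤ C₀) (hR0 : 0 ≤ R₀) (hC0 : 0 ≤ C₀) (hq : R₀ * C₀ < 1)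
    (nbr : ι → Finset ι) (hsymm : ∀ i j, j ∈ nbr i ↔ i ∈ nbr j) {W : ℕ}
    (hW : ∀ i, (nbr i).card ≤ W) (ht0 : ∀ i j, j ∉ nbr i → t i j = 0)
    (ar : ι → ι → ℝ) (har : ∀ i j, t i j * ((x₀ : 𝕜) - (ℓ j : 𝕜)) = (ar i j : 𝕜))
    (wgt : ι → ℝ) (hw0 : ∀ i, 0 ≤ wgt i) (hwℓ : ∀ i, wgt i ^ 2 ≤ 1 + |ℓ i|) {Kg : ℝ}
    (hK : 0 ≤ Kg) (ha : ∀ i j, j ∈ nbr i → ‖t i j * ((x₀ : 𝕜) - (ℓ j : 𝕜))‖ ≤ Kg * wgt j)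
    {L : ℝ} (hLnn : 0 ≤ L) (hL : ∀ i j, j ∈ nbr i → wgt i ≤ L * wgt j)
    {M : ℝ} (hM : ∀ i, ‖d i‖ * wgt i ≤ M)
    -- structure: the section pairing bound
    {s : ℝ}
    (hA : ∀ (G : Finset ι) (u : ι → 𝕜),
      RCLike.re (∑ i ∈ G, ∑ j ∈ G, conj (u i) * (t i j * ((x₀ : 𝕜) - (ℓ j : 𝕜))) * u j) ≤
        s * ∑ i ∈ G, ‖u i‖ ^ 2)
    -- structure: head cube, next cube, locality, the sections
    (Hd S₁ : Finset ι) (hHS : Hd ⊆ S₁) (hloc : ∀ i ∈ Hd, nbr i ⊆ S₁)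
    (F : ℕ → Finset ι) (hF : Monotone F) (hFex : ∀ i, ∃ n, i ∈ F n) (hFS : ∀ n, S₁ ⊆ F n)
    -- the bracket
    {a e : ℝ} (hae : a < e) (hex₀ : e ≤ x₀)
    -- TRANSCRIPT-SHAPED DATA at the end `a`
    (Bra : ↥Hd → ↥Hd → ℝ)
    (hBra : ∀ (v : ↥Hd → ℝ) (j : ↥Hd),
      ∑ m : ↥Hd, Bra j m * ((a - ℓ m) * v m - ∑ l : ↥Hd, ar m l * v l) = v j)
    {αa βBa βCa : ℝ} (hαa : 0 ≤ αa) (hβBa : 0 ≤ βBa) (hβCa : 0 ≤ βCa)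
    (hαMa : ∀ v : ↥Hd → ℝ, ∑ j : ↥Hd, (∑ m : ↥Hd, Bra j m * v m) ^ 2 ≤ αa ^ 2 * ∑ i : ↥Hd, v i ^ 2)
    (hβBMa : ∀ x : ι → ℝ, ∑ j : ↥Hd, (∑ m : ↥Hd, Bra j m * -∑ l ∈ nbr m \ Hd, ar m l * x l) ^ 2 ≤
      βBa ^ 2 * ∑ j ∈ Hd.biUnion nbr \ Hd, x j ^ 2)
    (hβCMa : ∀ v : ↥Hd → ℝ, ∑ i ∈ Hd.biUnion nbr \ Hd,
      (∑ j : ↥Hd, ar i j * ∑ m : ↥Hd, Bra j m * v m) ^ 2 ≤ βCa ^ 2 * ∑ i : ↥Hd, v i ^ 2)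
    {MU2a : ℝ} (hMU2a : 0 < MU2a)
    (hshella : ∀ x : ι → ℝ, (∀ i ∈ Hd, x i = 0) →
      MU2a * ∑ i ∈ S₁ \ Hd, x i ^ 2 ≤ ∑ i ∈ S₁ \ Hd, (a - ℓ i - s) * x i ^ 2 -
        ∑ i ∈ Hd.biUnion nbr \ Hd,
          (∑ j : ↥Hd, ar i j * ∑ m : ↥Hd, Bra j m * ∑ l ∈ nbr m \ Hd, ar m l * x l) * x i)
    (htaila : ∀ i ∉ S₁, MU2a ≤ a - ℓ i - s)
    -- TRANSCRIPT-SHAPED DATA at the end `e`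
    (Bre : ↥Hd → ↥Hd → ℝ)
    (hBre : ∀ (v : ↥Hd → ℝ) (j : ↥Hd),
      ∑ m : ↥Hd, Bre j m * ((e - ℓ m) * v m - ∑ l : ↥Hd, ar m l * v l) = v j)
    {αe βBe βCe : ℝ} (hαe : 0 ≤ αe) (hβBe : 0 ≤ βBe) (hβCe : 0 ≤ βCe)
    (hαMe : ∀ v : ↥Hd → ℝ, ∑ j : ↥Hd, (∑ m : ↥Hd, Bre j m * v m) ^ 2 ≤ αe ^ 2 * ∑ i : ↥Hd, v i ^ 2)
    (hβBMe : ∀ x : ι → ℝ, ∑ j : ↥Hd, (∑ m : ↥Hd, Bre j m * -∑ l ∈ nbr m \ Hd, ar m l * x l) ^ 2 ≤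
      βBe ^ 2 * ∑ j ∈ Hd.biUnion nbr \ Hd, x j ^ 2)
    (hβCMe : ∀ v : ↥Hd → ℝ, ∑ i ∈ Hd.biUnion nbr \ Hd,
      (∑ j : ↥Hd, ar i j * ∑ m : ↥Hd, Bre j m * v m) ^ 2 ≤ βCe ^ 2 * ∑ i : ↥Hd, v i ^ 2)
    {MU2e : ℝ} (hMU2e : 0 < MU2e)
    (hshelle : ∀ x : ι → ℝ, (∀ i ∈ Hd, x i = 0) →
      MU2e * ∑ i ∈ S₁ \ Hd, x i ^ 2 ≤ ∑ i ∈ S₁ \ Hd, (e - ℓ i - s) * x i ^ 2 -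
        ∑ i ∈ Hd.biUnion nbr \ Hd,
          (∑ j : ↥Hd, ar i j * ∑ m : ↥Hd, Bre j m * ∑ l ∈ nbr m \ Hd, ar m l * x l) * x i)
    (htaile : ∀ i ∉ S₁, MU2e ≤ e - ℓ i - s)
    -- opposite head determinant signs
    (hsign : (Matrix.of fun i j : ↥Hd => (if i = j then a - ℓ j else 0) - ar i j).det *
      (Matrix.of fun i j : ↥Hd => (if i = j then e - ℓ j else 0) - ar i j).det < 0) :
    ∃ T : H →L[𝕜] H, (∀ i j, ⟪b i, T (b j)⟫_𝕜 = t i j) ∧ ‖T‖ ≤ Real.sqrt (R₀ * C₀) ∧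
      ∃ lam ∈ Set.Ioo a e, ∃ v : H, ‖v‖ = 1 ∧
        (∀ i, (ℓ i : 𝕜) * ⟪b i, v⟫_𝕜 +
            ∑ j ∈ nbr i, (t i j * ((x₀ : 𝕜) - (ℓ j : 𝕜))) * ⟪b j, v⟫_𝕜 = (lam : 𝕜) * ⟪b i, v⟫_𝕜) ∧
        ∀ s : ℕ, Summable fun i => wgt i ^ (2 * s) * ‖⟪b i, v⟫_𝕜‖ ^ 2 := by
  -- real-matrix data derived from the structural hypotheses
  have hAr := real_pairing_of_complex t x₀ ℓ ar har hA
  have har0 := ar_eq_zero_of_not_mem t x₀ ℓ ar har nbr ht0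
  have harg := abs_ar_le t x₀ ℓ ar har nbr wgt ha
  have hloc' : ∀ i ∈ Hd, ∀ j ∉ S₁, ar i j = 0 ∧ ar j i = 0 := by
    intro i hi j hj
    have h1 : j ∉ nbr i := fun h => hj (hloc i hi h)
    have h2 : i ∉ nbr j := fun h => h1 ((hsymm j i).mp h)
    exact ⟨har0 i j h1, har0 j i h2⟩
  -- matrix left inverses on the head
  have hN₁ := matrix_leftInverse_of_fun ℓ ar Hd a Bra hBra
  have hN₂ := matrix_leftInverse_of_fun ℓ ar Hd e Bre hBre
  -- shell forms on the shell subtype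
  have hX₁ := shellForm_of_shellTest ℓ ar nbr hsymm har0 Hd S₁ hloc a s MU2a Bra hshella
  have hX₂ := shellForm_of_shellTest ℓ ar nbr hsymm har0 Hd S₁ hloc e s MU2e Bre hshelle
  -- EXISTENCE: section data for the family `F`
  obtain ⟨c, xs, hxs, hcF, hnorm, heig, hgraph⟩ :=
    SkewCutGalerkinSectionData.section_data_of_transcripts ar ℓ hℓ s hAr nbr hsymm hW har0 wgt hwℓ harg
      Hd S₁ hHS hloc' hae x₀ hex₀ _ _ hN₁ hN₂ hMU2a hMU2e hX₁ hX₂ htaila htaile hsign F hFS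
  obtain ⟨hnorm', heig', hgraph'⟩ :=
    SkewCutGalerkinSectionData.section_data_cast (𝕜 := 𝕜) ar ℓ x₀ F c xs hnorm heig hgraph
  -- the graph-bound constant
  set C2 : ℝ := 2 * (x₀ - a) ^ 2 + 2 * ((W : ℝ) ^ 2 * Kg ^ 2) * (1 + (s - a)) with hC2
  have hC2nn : 0 ≤ C2 := (Finset.sum_nonneg fun j _ => sq_nonneg _).trans (hgraph 0)
  have hCsq : Real.sqrt C2 ^ 2 = C2 := Real.sq_sqrt hC2nn
  -- the eigen-equations in the chain's syntax
  have heig'' : ∀ n, ∀ i ∈ F n, (ℓ i : 𝕜) * (c n i : 𝕜) +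
      ∑ j ∈ F n, (t i j * ((x₀ : 𝕜) - (ℓ j : 𝕜))) * (c n j : 𝕜) = (xs n : 𝕜) * (c n i : 𝕜) := by
    intro n i hi; simp_rw [har]; exact heig' n i hi
  have hgraph'' : ∀ n, ∑ j ∈ F n, ‖((x₀ : 𝕜) - (ℓ j : 𝕜)) * (c n j : 𝕜)‖ ^ 2 ≤ Real.sqrt C2 ^ 2 := by
    intro n; rw [hCsq]; exact hgraph' n
  -- LIMIT + OPEN BRACKET: the real-data END-TO-END theorem
  exact SkewCutGalerkinRealShell.exists_smooth_eigenvector_Ioo_of_sections_of_real_resolvent_data b ℓ x₀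
    d hd hd0 t hrow hR hcol hC₀ hR0 hC0 hq nbr hsymm hW ht0 ar har wgt hw0 hwℓ hK ha hLnn hL hM F hF
    hFex (fun n i => (c n i : 𝕜)) xs hxs heig'' hnorm' (Real.sqrt_nonneg _) hgraph'' hA
    Hd Bra hBra hαa hβBa hβCa hαMa hβBMa hβCMa hMU2a (S₁ \ Hd) hshella
    (fun i hi hi' => htaila i fun h => hi' (Finset.mem_sdiff.mpr ⟨h, hi⟩))
    Hd Bre hBre hαe hβBe hβCe hαMe hβBMe hβCMe hMU2e (S₁ \ Hd) hshelle
    (fun i hi hi' => htaile i fun h => hi' (Finset.mem_sdiff.mpr ⟨h, hi⟩))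

/-! ### §3 (append, instab3 g6) The converse shape conversion: the shell form on the shell subtype
### gives the shell test on head-vanishing vectors -/

/-- **Converse of `shellForm_of_shellTest`.** If the shell form holds on the shell subtype
`↥(S₁ ∖ H)` (the shape of instab3 g3's `exists_eigenvalue_of_certificate` / instab4 g6's
`isLinNSEigenvalue_of_certificate`, with the off-head blocks `−ar`), then the shell test holds for
every real vector on `ι` vanishing on the head `H` (the shape of `SkewCutGalerkinRealShell` /
`SkewCutGalerkinMinimalTranscripts`) — by the same locality bookkeeping (only values on the shell
enter). So the two shapes are EQUIVALENT transcripts of the (V5) test. -/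
theorem shellTest_of_shellForm (ℓ : ι → ℝ) (ar : ι → ι → ℝ) (nbr : ι → Finset ι)
    (hsymm : ∀ i j, j ∈ nbr i ↔ i ∈ nbr j) (har0 : ∀ i j, j ∉ nbr i → ar i j = 0)
    (H S₁ : Finset ι) (hloc : ∀ i ∈ H, nbr i ⊆ S₁) (z s MU2 : ℝ) (Br : ↥H → ↥H → ℝ)
    (hX : ∀ w : ↥(S₁ \ H) → ℝ, MU2 * ∑ i, w i ^ 2 ≤ ∑ i : ↥(S₁ \ H), (z - ℓ i.1 - s) * w i ^ 2 -
      w ⬝ᵥ (((Matrix.of fun (i : ↥(S₁ \ H)) (j : ↥H) => -ar i j) * (Matrix.of fun j m : ↥H => Br j m) *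
        (Matrix.of fun (i : ↥H) (j : ↥(S₁ \ H)) => -ar i j)) *ᵥ w)) :
    ∀ x : ι → ℝ, (∀ i ∈ H, x i = 0) →
      MU2 * ∑ i ∈ S₁ \ H, x i ^ 2 ≤ ∑ i ∈ S₁ \ H, (z - ℓ i - s) * x i ^ 2 -
        ∑ i ∈ H.biUnion nbr \ H,
          (∑ j : ↥H, ar i j * ∑ m : ↥H, Br j m * ∑ l ∈ nbr m \ H, ar m l * x l) * x i := by
  intro x _
  -- restrict `x` to the shell
  let w : ↥(S₁ \ H) → ℝ := fun i => x i.1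
  have key := hX w
  have e1 : ∑ i ∈ S₁ \ H, x i ^ 2 = ∑ i : ↥(S₁ \ H), w i ^ 2 := by
    rw [← Finset.sum_coe_sort]
  have e2 : ∑ i ∈ S₁ \ H, (z - ℓ i - s) * x i ^ 2 = ∑ i : ↥(S₁ \ H), (z - ℓ i.1 - s) * w i ^ 2 := by
    rw [← Finset.sum_coe_sort]
  have e3 : ∀ m : ↥H, ∑ l ∈ nbr m \ H, ar m l * x l = ∑ l : ↥(S₁ \ H), ar m l * w l := by
    intro m
    have hsub : nbr m \ H ⊆ S₁ \ H := fun l hl => by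
      have hl' := Finset.mem_sdiff.mp hl
      exact Finset.mem_sdiff.mpr ⟨hloc m m.2 hl'.1, hl'.2⟩
    rw [Finset.sum_subset hsub fun l hl hln => by
      have : l ∉ nbr m := fun h => hln (Finset.mem_sdiff.mpr ⟨h, (Finset.mem_sdiff.mp hl).2⟩)
      rw [har0 m l this, zero_mul], ← Finset.sum_coe_sort]
  have e4 : ∑ i ∈ H.biUnion nbr \ H,
      (∑ j : ↥H, ar i j * ∑ m : ↥H, Br j m * ∑ l ∈ nbr m \ H, ar m l * x l) * x i =
      ∑ i : ↥(S₁ \ H), (∑ j : ↥H, ar i j * ∑ m : ↥H, Br j m * ∑ l : ↥(S₁ \ H), ar m l * w l) * w i := by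
    have hsub : H.biUnion nbr \ H ⊆ S₁ \ H := fun i hi => by
      have hi' := Finset.mem_sdiff.mp hi
      obtain ⟨j, hj, hij⟩ := Finset.mem_biUnion.mp hi'.1
      exact Finset.mem_sdiff.mpr ⟨hloc j hj hij, hi'.2⟩
    rw [Finset.sum_subset hsub fun i hi hin => by
      have hz : ∀ j : ↥H, ar i j = 0 := fun j => by
        refine har0 i j fun h => hin (Finset.mem_sdiff.mpr ⟨?_, (Finset.mem_sdiff.mp hi).2⟩)
        exact Finset.mem_biUnion.mpr ⟨j, j.2, (hsymm i j).mp h⟩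
      simp [hz], ← Finset.sum_coe_sort]
    refine Finset.sum_congr rfl fun i _ => ?_
    simp_rw [e3]
    rfl
  have e5 : w ⬝ᵥ (((Matrix.of fun (i : ↥(S₁ \ H)) (j : ↥H) => -ar i j) *
      (Matrix.of fun j m : ↥H => Br j m) * (Matrix.of fun (i : ↥H) (j : ↥(S₁ \ H)) => -ar i j)) *ᵥ w) =
      ∑ i : ↥(S₁ \ H), (∑ j : ↥H, ar i j * ∑ m : ↥H, Br j m * ∑ l : ↥(S₁ \ H), ar m l * w l) * w i := by
    rw [dotProduct]
    refine Finset.sum_congr rfl fun i _ => ?_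
    rw [← Matrix.mulVec_mulVec, ← Matrix.mulVec_mulVec, mul_comm]
    congr 1
    rw [Matrix.mulVec, dotProduct]
    refine Finset.sum_congr rfl fun j _ => ?_
    rw [Matrix.of_apply, Matrix.mulVec, dotProduct]
    have : ∀ m : ↥H, (Matrix.of fun j m : ↥H => Br j m) j m *
        ((Matrix.of fun (i : ↥H) (j : ↥(S₁ \ H)) => -ar i j) *ᵥ w) m =
        -(Br j m * ∑ l : ↥(S₁ \ H), ar m l * w l) := by
      intro m
      rw [Matrix.of_apply, Matrix.mulVec, dotProduct]
      simp only [Matrix.of_apply, neg_mul, Finset.sum_neg_distrib, mul_neg]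
    simp_rw [this]
    rw [Finset.sum_neg_distrib]
    ring
  rw [e1, e2, e4, ← e5]
  exact key

end Summit.NavierStokesRegularity.FluidComputer.SkewCutGalerkinFromTranscripts

end
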